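import Summits.RiemannHypothesis.RiemannHypothesis.Theses.SpectralTrace
import Literature.NumberTheory.LFunctions.WeilMellinInversion
import HarnessLib

/-!
# Crux `SpectralThesis` (stmt-RiemannHypothesis-0187), line `Sketch` — stub `stub_kernelToolkit`

Fourier kernels `K(t) = (2π)⁻¹ ∫ σ(x) cos(tx) dx` of even real smooth compactly supported symbols.
Everything is read off the dictionary `σ̂(1/2 + it) = ∫ σ(x) e^{itx} dx = 2π K(t)` (`weilMellin`
of the Weil test `x ↦ (σ x : ℂ)` on the critical line; the sine part vanishes by oddness):
`C²` regularity by the chain rule on `hasDerivAt_weilMellin` (`d/dt ĝ(1/2+it) = (ixg)^(1/2+it)`),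
decay from `norm_weilMellin_le_of_abs_re_le` (and `weilMellin_deriv_deriv` once more for
`O((1+t²)⁻²)`), inversion `∫ K(t) e^{∓itx} dt = σ(x)` from `weilMellin_inversion` at `c = 1/2`,
dilation by `Measure.integral_comp_div`, and the two reproducing identities by Fubini
(`integral_integral_swap`) and the complex inversion formula.
-/

noncomputable section

set_option linter.dupNamespace false

open Complex Set MeasureTheory Filter
open scoped Real ContDiff Topology

namespace Summit.RiemannHypothesis.RiemannHypothesis.Theorems.SpectralThesis.Sketch

open Literature.NumberTheory.LFunctions

namespace KernelToolkit

/-! ## The transform of a test function on the critical line -/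

/-- Chain rule on the critical line: `d/dt ĝ(1/2 + it) = (x ↦ i x g(x))^(1/2 + it)` for `g`
continuous of compact support. [folklore] -/
theorem hasDerivAt_weilMellin_line {g : ℝ → ℂ} (hg : Continuous g) (hg' : HasCompactSupport g)
    (t : ℝ) :
    HasDerivAt (fun s : ℝ => weilMellin g (1 / 2 + (s : ℂ) * I))
      (weilMellin (fun x : ℝ => I * (x : ℂ) * g x) (1 / 2 + (t : ℂ) * I)) t := by
  have hh : HasDerivAt (fun s : ℝ => (1 / 2 : ℂ) + (s : ℂ) * I) (1 * I) t :=
    ((hasDerivAt_id t).ofReal_comp.mul_const I).const_add (1 / 2 : ℂ)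
  have hcomp := (hasDerivAt_weilMellin hg hg' (1 / 2 + (t : ℂ) * I)).comp t hh
  have e : (∫ x : ℝ, g x * ((x : ℂ) * cexp ((1 / 2 + (t : ℂ) * I - 1 / 2) * (x : ℂ)))) * I =
      weilMellin (fun x : ℝ => I * (x : ℂ) * g x) (1 / 2 + (t : ℂ) * I) := by
    rw [weilMellin, ← integral_mul_const]
    congr 1 with x
    ring
  rwa [one_mul, e] at hcomp

/-- Real parts: `t ↦ a · Re ĝ(1/2 + it)` has derivative `a · Re (x ↦ i x g(x))^(1/2 + it)`.
[folklore] -/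
theorem hasDerivAt_re_weilMellin_line {g : ℝ → ℂ} (hg : Continuous g)
    (hg' : HasCompactSupport g) (a t : ℝ) :
    HasDerivAt (fun s : ℝ => a * (weilMellin g (1 / 2 + (s : ℂ) * I)).re)
      (a * (weilMellin (fun x : ℝ => I * (x : ℂ) * g x) (1 / 2 + (t : ℂ) * I)).re) t := by
  have h2 := Complex.reCLM.hasFDerivAt.comp_hasDerivAt t (hasDerivAt_weilMellin_line hg hg' t)
  have hre : HasDerivAt (fun s : ℝ => (weilMellin g (1 / 2 + (s : ℂ) * I)).re)
      (weilMellin (fun x : ℝ => I * (x : ℂ) * g x) (1 / 2 + (t : ℂ) * I)).re t :=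
    h2.congr_deriv (by simp)
  exact hre.const_mul a

/-- `t ↦ a · Re ĝ(1/2 + it)` is continuous. [folklore] -/
theorem continuous_re_weilMellin_line {g : ℝ → ℂ} (hg : Continuous g)
    (hg' : HasCompactSupport g) (a : ℝ) :
    Continuous (fun s : ℝ => a * (weilMellin g (1 / 2 + (s : ℂ) * I)).re) :=
  continuous_const.mul (Complex.continuous_re.comp
    ((continuous_weilMellin hg hg').comp (by fun_prop)))

/-- `x ↦ i x g(x)` is again a Weil test. [folklore] -/
theorem isWeilTest_mul_I_ofReal {g : ℝ → ℂ} (hg : IsWeilTest g) :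
    IsWeilTest (fun x : ℝ => I * (x : ℂ) * g x) :=
  ⟨(contDiff_const.mul Complex.ofRealCLM.contDiff).mul hg.1, hg.2.mul_left⟩

/-- A real smooth compactly supported symbol is a Weil test. [folklore] -/
theorem isWeilTest_ofReal {σ : ℝ → ℝ} (hσ : ContDiff ℝ ∞ σ) (hσs : HasCompactSupport σ) :
    IsWeilTest (fun x => (σ x : ℂ)) :=
  ⟨Complex.ofRealCLM.contDiff.comp hσ, hσs.comp_left Complex.ofReal_zero⟩

/-- Decay on the critical line: `‖ĝ(1/2 + it)‖ ≤ C_{g,0}/(1 + t²)`. [folklore] -/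
theorem norm_weilMellin_line_le {g : ℝ → ℂ} (hg : IsWeilTest g) (t : ℝ) :
    ‖weilMellin g (1 / 2 + (t : ℂ) * I)‖ ≤ weilDecayW 0 g / (1 + t ^ 2) := by
  have h := norm_weilMellin_le_of_abs_re_le hg (A := 0) (s := 1 / 2 + (t : ℂ) * I) (by simp)
  simpa using h

/-- `|a · Re ĝ(1/2 + it)| ≤ |a| C_{g,0}/(1 + t²)`. [folklore] -/
theorem abs_re_weilMellin_line_le {g : ℝ → ℂ} (hg : IsWeilTest g) (a t : ℝ) :
    |a * (weilMellin g (1 / 2 + (t : ℂ) * I)).re| ≤ |a| * weilDecayW 0 g / (1 + t ^ 2) := by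
  rw [abs_mul, mul_div_assoc]
  exact mul_le_mul_of_nonneg_left
    ((Complex.abs_re_le_norm _).trans (norm_weilMellin_line_le hg t)) (abs_nonneg a)

/-- Decay `O((1+t²)⁻²)` on the critical line: `‖ĝ(1/2 + it)‖ ≤ (C_{g,0} + C_{g'',0})/(1 + t²)²`
(`(g'')^ = (s - 1/2)² ĝ`). [folklore] -/
theorem norm_weilMellin_line_le_sq {g : ℝ → ℂ} (hg : IsWeilTest g) (t : ℝ) :
    ‖weilMellin g (1 / 2 + (t : ℂ) * I)‖ ≤
      (weilDecayW 0 g + weilDecayW 0 (deriv (deriv g))) / (1 + t ^ 2) ^ 2 := by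
  have h0 := norm_weilMellin_line_le hg t
  have h2 := norm_weilMellin_line_le hg.deriv.deriv t
  rw [weilMellin_deriv_deriv hg, norm_mul] at h2
  have e : ‖((1 / 2 : ℂ) + (t : ℂ) * I - 1 / 2) ^ 2‖ = t ^ 2 := by
    rw [show (1 / 2 : ℂ) + (t : ℂ) * I - 1 / 2 = (t : ℂ) * I by ring, norm_pow, norm_mul,
      Complex.norm_real, Complex.norm_I, mul_one, Real.norm_eq_abs, sq_abs]
  rw [e] at h2
  have hpos : 0 < 1 + t ^ 2 := by positivity
  rw [le_div_iff₀ hpos] at h0 h2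
  rw [le_div_iff₀ (by positivity)]
  linear_combination h0 + h2

/-! ## Even real symbols: the cosine transform -/

/-- For an even real symbol: `σ̂(1/2 + it) = ∫ σ(x) cos(tx) dx` (the sine part vanishes by
oddness). [folklore] -/
theorem weilMellin_ofReal_even_line {σ : ℝ → ℝ} (hσc : Continuous σ) (hσs : HasCompactSupport σ)
    (hσe : ∀ x, σ (-x) = σ x) (t : ℝ) :
    weilMellin (fun x => (σ x : ℂ)) (1 / 2 + (t : ℂ) * I) =
      ((∫ x, σ x * Real.cos (t * x) : ℝ) : ℂ) := by
  have hsin : ∫ x, σ x * Real.sin (t * x) = 0 := by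
    have h := integral_neg_eq_self (fun x => σ x * Real.sin (t * x)) volume
    simp only [mul_neg, Real.sin_neg, hσe, integral_neg] at h
    linarith
  have hci : Integrable fun x : ℝ => ((σ x * Real.cos (t * x) : ℝ) : ℂ) :=
    ((hσc.mul (by fun_prop)).integrable_of_hasCompactSupport hσs.mul_right).ofReal
  have hsi : Integrable fun x : ℝ => ((σ x * Real.sin (t * x) : ℝ) : ℂ) * I :=
    ((hσc.mul (by fun_prop)).integrable_of_hasCompactSupport hσs.mul_right).ofReal.mul_const I
  have e : ∀ x : ℝ, (σ x : ℂ) * cexp ((1 / 2 + (t : ℂ) * I - 1 / 2) * (x : ℂ)) =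
      ((σ x * Real.cos (t * x) : ℝ) : ℂ) + ((σ x * Real.sin (t * x) : ℝ) : ℂ) * I := by
    intro x
    rw [show (1 / 2 + (t : ℂ) * I - 1 / 2) * (x : ℂ) = ((t * x : ℝ) : ℂ) * I by push_cast; ring,
      Complex.exp_mul_I]
    push_cast
    ring
  simp_rw [weilMellin, e]
  rw [integral_add hci hsi, integral_mul_const, integral_complex_ofReal, integral_complex_ofReal,
    hsin]
  simp

/-- Change of variables `x = A y`: the kernel of the dilated symbol `σ(x/A)` is `A K(At)`.
[folklore] -/
theorem kernel_dilation (σ : ℝ → ℝ) {A : ℝ} (hA : 0 < A) (t : ℝ) :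
    1 / (2 * π) * ∫ x, σ (x / A) * Real.cos (t * x) =
      A * (1 / (2 * π) * ∫ x, σ x * Real.cos (A * t * x)) := by
  have h := Measure.integral_comp_div (fun y : ℝ => σ y * Real.cos (A * t * y)) A
  have e : ∀ x : ℝ, σ (x / A) * Real.cos (t * x) = σ (x / A) * Real.cos (A * t * (x / A)) := by
    intro x
    rw [mul_comm A t, mul_assoc, mul_div_cancel₀ x hA.ne']
  simp_rw [e]
  rw [h, abs_of_pos hA, smul_eq_mul]
  ring

/-! ## Fourier inversion for the kernel -/

/-- Complex Fourier inversion for the kernel: `∫ K(u) e^{-iux} du = σ(x)` (Mellin inversion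
`weilMellin_inversion` at `c = 1/2` for the Weil test `x ↦ (σ x : ℂ)`, with `σ̂ = 2πK`).
[folklore] -/
theorem kernel_inversion {σ : ℝ → ℝ} {K : ℝ → ℝ} (hσ : ContDiff ℝ ∞ σ)
    (hσs : HasCompactSupport σ) (hσe : ∀ x, σ (-x) = σ x)
    (hK : ∀ t, K t = 1 / (2 * π) * ∫ x, σ x * Real.cos (t * x)) (x : ℝ) :
    ∫ u, (K u : ℂ) * cexp (-((u : ℂ) * I) * (x : ℂ)) = (σ x : ℂ) := by
  have h := weilMellin_inversion (isWeilTest_ofReal hσ hσs) (1 / 2) x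
  rw [show ((1 / 2 : ℝ) : ℂ) = 1 / 2 by push_cast; ring] at h
  simp only [sub_self, zero_mul, Complex.exp_zero, mul_one] at h
  have hπ : (π : ℝ) ≠ 0 := Real.pi_ne_zero
  have hF : ∀ y : ℝ, weilMellin (fun x => (σ x : ℂ)) (1 / 2 + (y : ℂ) * I) =
      2 * π * (K y : ℂ) := by
    intro y
    have hr : 2 * π * K y = ∫ x, σ x * Real.cos (y * x) := by
      rw [hK]; field_simp
    rw [weilMellin_ofReal_even_line hσ.continuous hσs hσe, ← hr]
    push_cast
    ring
  simp_rw [hF] at h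
  simp_rw [mul_assoc (2 * (π : ℂ))] at h
  rw [integral_const_mul] at h
  exact mul_left_cancel₀ (mul_ne_zero two_ne_zero (Complex.ofReal_ne_zero.2 Real.pi_ne_zero)) h

/-- Complex Fourier inversion, conjugate frequency: `∫ K(u) e^{iux} du = σ(x)` (evenness of `σ`).
[folklore] -/
theorem kernel_inversion' {σ : ℝ → ℝ} {K : ℝ → ℝ} (hσ : ContDiff ℝ ∞ σ)
    (hσs : HasCompactSupport σ) (hσe : ∀ x, σ (-x) = σ x)
    (hK : ∀ t, K t = 1 / (2 * π) * ∫ x, σ x * Real.cos (t * x)) (x : ℝ) :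
    ∫ u, (K u : ℂ) * cexp ((u : ℂ) * (x : ℂ) * I) = (σ x : ℂ) := by
  have h := kernel_inversion hσ hσs hσe hK (-x)
  rw [hσe] at h
  rw [← h]
  congr 1 with u
  congr 2
  push_cast
  ring

/-- Real Fourier inversion for the kernel: `∫ K(t) cos(tx) dt = σ(x)`. [folklore] -/
theorem kernel_inversion_real {σ : ℝ → ℝ} {K : ℝ → ℝ} (hσ : ContDiff ℝ ∞ σ)
    (hσs : HasCompactSupport σ) (hσe : ∀ x, σ (-x) = σ x)
    (hK : ∀ t, K t = 1 / (2 * π) * ∫ x, σ x * Real.cos (t * x))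
    (hKi : Integrable K) (x : ℝ) :
    ∫ t, K t * Real.cos (t * x) = σ x := by
  have h := kernel_inversion' hσ hσs hσe hK x
  have hint : Integrable (fun u : ℝ => (K u : ℂ) * cexp ((u : ℂ) * (x : ℂ) * I)) :=
    hKi.ofReal.mul_bdd (by fun_prop : Continuous fun u : ℝ =>
      cexp ((u : ℂ) * (x : ℂ) * I)).aestronglyMeasurable
      (Eventually.of_forall fun u => by
        rw [show (u : ℂ) * (x : ℂ) * I = ((u * x : ℝ) : ℂ) * I by push_cast; ring,
          Complex.norm_exp_ofReal_mul_I])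
  have hre := integral_re hint
  rw [h] at hre
  simp only [RCLike.re_to_complex, Complex.ofReal_re] at hre
  rw [← hre]
  congr 1 with u
  rw [Complex.re_ofReal_mul, Complex.exp_re]
  simp

/-! ## The two reproducing identities (Fubini) -/

/-- The Weil integrand on the critical line is unimodular: `‖e^{(1/2 + it - 1/2)x}‖ = 1`.
[folklore] -/
theorem norm_cexp_line (t x : ℝ) : ‖cexp ((1 / 2 + (t : ℂ) * I - 1 / 2) * (x : ℂ))‖ = 1 := by
  rw [show (1 / 2 + (t : ℂ) * I - 1 / 2) * (x : ℂ) = ((t * x : ℝ) : ℂ) * I by push_cast; ring,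
    Complex.norm_exp_ofReal_mul_I]

/-- First reproducing identity: `∫ K(t - s) ĝ(s) ds = (σ g)^(t)` on the critical line, for `K`
continuous integrable with `∫ K(u) e^{-iux} du = σ(x)` and `g` continuous of compact support
(Fubini and the substitution `s = t - u`). [folklore] -/
theorem integral_kernel_sub_mul_weilMellin {σ : ℝ → ℝ} {K : ℝ → ℝ} {g : ℝ → ℂ}
    (hKc : Continuous K) (hKi : Integrable K)
    (hinv : ∀ x : ℝ, ∫ u, (K u : ℂ) * cexp (-((u : ℂ) * I) * (x : ℂ)) = (σ x : ℂ))
    (hg : Continuous g) (hg' : HasCompactSupport g) (t : ℝ) :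
    ∫ s, (K (t - s) : ℂ) * weilMellin g (1 / 2 + (s : ℂ) * I) =
      weilMellin (fun x => (σ x : ℂ) * g x) (1 / 2 + (t : ℂ) * I) := by
  have hgi : Integrable g := hg.integrable_of_hasCompactSupport hg'
  have e1 : ∀ s : ℝ, (K (t - s) : ℂ) * weilMellin g (1 / 2 + (s : ℂ) * I) =
      ∫ x, (K (t - s) : ℂ) * (g x * cexp ((1 / 2 + (s : ℂ) * I - 1 / 2) * (x : ℂ))) :=
    fun s => (integral_const_mul _ _).symm
  simp_rw [e1]
  have hint : Integrable (Function.uncurry fun (s : ℝ) (x : ℝ) =>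
      (K (t - s) : ℂ) * (g x * cexp ((1 / 2 + (s : ℂ) * I - 1 / 2) * (x : ℂ))))
      ((volume : Measure ℝ).prod volume) := by
    refine Integrable.mono' ((hKi.comp_sub_left t).norm.mul_prod hgi.norm) ?_
      (Eventually.of_forall fun p => ?_)
    · exact Continuous.aestronglyMeasurable (by fun_prop)
    · obtain ⟨s, x⟩ := p
      simp only [Function.uncurry_apply_pair, norm_mul, Complex.norm_real, norm_cexp_line,
        mul_one, le_refl]
  rw [integral_integral_swap hint]
  unfold weilMellin
  congr 1 with x
  beta_reduce
  have hsub := integral_sub_left_eq_self (fun u : ℝ => (K u : ℂ) *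
    (g x * cexp ((1 / 2 + ((t - u : ℝ) : ℂ) * I - 1 / 2) * (x : ℂ)))) volume t
  simp only [sub_sub_cancel] at hsub
  rw [hsub, ← hinv x, ← integral_mul_const, ← integral_mul_const]
  congr 1 with u
  rw [show cexp ((1 / 2 + ((t - u : ℝ) : ℂ) * I - 1 / 2) * (x : ℂ)) =
      cexp (-((u : ℂ) * I) * (x : ℂ)) * cexp ((1 / 2 + (t : ℂ) * I - 1 / 2) * (x : ℂ)) by
    rw [← Complex.exp_add]; congr 1; push_cast; ring]
  ring

/-- Second reproducing identity: `∫ ĝ(t) K(t) dt = ∫ g(x) σ(x) dx`, for `K` continuous integrable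
with `∫ K(u) e^{iux} du = σ(x)` and `g` continuous of compact support (Fubini). [folklore] -/
theorem integral_weilMellin_mul_kernel {σ : ℝ → ℝ} {K : ℝ → ℝ} {g : ℝ → ℂ}
    (hKc : Continuous K) (hKi : Integrable K)
    (hinv : ∀ x : ℝ, ∫ u, (K u : ℂ) * cexp ((u : ℂ) * (x : ℂ) * I) = (σ x : ℂ))
    (hg : Continuous g) (hg' : HasCompactSupport g) :
    ∫ t : ℝ, weilMellin g (1 / 2 + (t : ℂ) * I) * (K t : ℂ) = ∫ x, g x * (σ x : ℂ) := by
  have hgi : Integrable g := hg.integrable_of_hasCompactSupport hg'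
  have e1 : ∀ t : ℝ, weilMellin g (1 / 2 + (t : ℂ) * I) * (K t : ℂ) =
      ∫ x, g x * cexp ((1 / 2 + (t : ℂ) * I - 1 / 2) * (x : ℂ)) * (K t : ℂ) :=
    fun t => (integral_mul_const _ _).symm
  simp_rw [e1]
  have hint : Integrable (Function.uncurry fun (t : ℝ) (x : ℝ) =>
      g x * cexp ((1 / 2 + (t : ℂ) * I - 1 / 2) * (x : ℂ)) * (K t : ℂ))
      ((volume : Measure ℝ).prod volume) := by
    refine Integrable.mono' (hKi.norm.mul_prod hgi.norm) ?_ (Eventually.of_forall fun p => ?_)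
    · exact Continuous.aestronglyMeasurable (by fun_prop)
    · obtain ⟨t, x⟩ := p
      simp only [Function.uncurry_apply_pair, norm_mul, Complex.norm_real, norm_cexp_line,
        mul_one]
      rw [mul_comm]
  rw [integral_integral_swap hint]
  congr 1 with x
  rw [← hinv x, ← integral_const_mul]
  congr 1 with t
  rw [show (1 / 2 + (t : ℂ) * I - 1 / 2) * (x : ℂ) = (t : ℂ) * (x : ℂ) * I by ring]
  ring

end KernelToolkit

open KernelToolkit in
/-- **Kernel toolkit.** Part 1: for an even real `C_c^∞` symbol `σ`, the kernel
`K(t) = (2π)⁻¹ ∫ σ(x) cos(tx) dx` is `C²` with `K, K', K''` all `O(1/(1+t²))`, even, satisfies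
Fourier inversion `∫ K(t) cos(tx) dt = σ(x)`, the dilation rule, and the two reproducing identities
against `ĝ(t) = weilMellin g (1/2 + it)`. Part 2: for a Weil test `g`, `t ↦ ĝ(1/2 + it)` has
derivative `(x ↦ i x g(x))^(1/2 + it)`, `x ↦ i x g(x)` is a Weil test with no larger support, and
`‖ĝ(1/2 + it)‖ = O((1+t²)⁻²)`. [folklore] -/
theorem stub_kernelToolkit :
    ((∀ σ : ℝ → ℝ, ContDiff ℝ ∞ σ → HasCompactSupport σ → (∀ x, σ (-x) = σ x) →
      ∃ (K dK ddK : ℝ → ℝ) (C : ℝ),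
        (∀ t, K t = 1 / (2 * π) * ∫ x, σ x * Real.cos (t * x)) ∧
        (∀ t, HasDerivAt K (dK t) t) ∧ (∀ t, HasDerivAt dK (ddK t) t) ∧ Continuous ddK ∧
        (∀ t, K (-t) = K t) ∧
        (∀ t, |K t| ≤ C / (1 + t ^ 2)) ∧ (∀ t, |dK t| ≤ C / (1 + t ^ 2)) ∧
        (∀ t, |ddK t| ≤ C / (1 + t ^ 2)) ∧
        (∀ x, (∫ t, K t * Real.cos (t * x)) = σ x) ∧
        (∀ A : ℝ, 0 < A → ∀ t, (1 / (2 * π) * ∫ x, σ (x / A) * Real.cos (t * x)) = A * K (A * t)) ∧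
        (∀ g : ℝ → ℂ, Continuous g → HasCompactSupport g →
          (∀ t : ℝ, (∫ s, (K (t - s) : ℂ) * weilMellin g (1 / 2 + (s : ℂ) * I)) =
              weilMellin (fun x => (σ x : ℂ) * g x) (1 / 2 + (t : ℂ) * I)) ∧
          (∫ t : ℝ, weilMellin g (1 / 2 + (t : ℂ) * I) * (K t : ℂ)) = ∫ x, g x * (σ x : ℂ))) ∧
    (∀ g : ℝ → ℂ, IsWeilTest g →
      (∀ t : ℝ, HasDerivAt (fun s : ℝ => weilMellin g (1 / 2 + (s : ℂ) * I))
          (weilMellin (fun x : ℝ => I * (x : ℂ) * g x) (1 / 2 + (t : ℂ) * I)) t) ∧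
      IsWeilTest (fun x : ℝ => I * (x : ℂ) * g x) ∧
      tsupport (fun x : ℝ => I * (x : ℂ) * g x) ⊆ tsupport g ∧
      ∃ C : ℝ, ∀ t : ℝ, ‖weilMellin g (1 / 2 + (t : ℂ) * I)‖ ≤ C / (1 + t ^ 2) ^ 2)) := by
  refine ⟨fun σ hσ hσs hσe => ?_, fun g hg => ⟨fun t => hasDerivAt_weilMellin_line hg.1.continuous
    hg.2 t, isWeilTest_mul_I_ofReal hg, tsupport_mul_subset_right, _,
    fun t => norm_weilMellin_line_le_sq hg t⟩⟩
  -- Part 1: the symbol `σ` and its moments `ixσ`, `(ix)²σ` as Weil tests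
  have hW₀ : IsWeilTest (fun x => (σ x : ℂ)) := isWeilTest_ofReal hσ hσs
  have hW₁ : IsWeilTest (fun x : ℝ => I * (x : ℂ) * (σ x : ℂ)) := isWeilTest_mul_I_ofReal hW₀
  have hW₂ : IsWeilTest (fun x : ℝ => I * (x : ℂ) * (I * (x : ℂ) * (σ x : ℂ))) :=
    isWeilTest_mul_I_ofReal hW₁
  obtain ⟨K, hK⟩ : ∃ K : ℝ → ℝ, K = fun t => 1 / (2 * π) * ∫ x, σ x * Real.cos (t * x) :=
    ⟨_, rfl⟩
  have hKt : ∀ t, K t = 1 / (2 * π) * ∫ x, σ x * Real.cos (t * x) := fun t => by rw [hK]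
  have hKre : K = fun t : ℝ => 1 / (2 * π) *
      (weilMellin (fun x => (σ x : ℂ)) (1 / 2 + (t : ℂ) * I)).re := by
    rw [hK]
    funext t
    rw [weilMellin_ofReal_even_line hσ.continuous hσs hσe t, Complex.ofReal_re]
  have hKc : Continuous K := by
    rw [hKre]
    exact continuous_re_weilMellin_line hW₀.1.continuous hW₀.2 _
  have hKd : ∀ t : ℝ, HasDerivAt K (1 / (2 * π) *
      (weilMellin (fun x : ℝ => I * (x : ℂ) * (σ x : ℂ)) (1 / 2 + (t : ℂ) * I)).re) t := by
    intro t
    rw [hKre]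
    exact hasDerivAt_re_weilMellin_line hW₀.1.continuous hW₀.2 _ t
  have h2π : (0 : ℝ) < 1 / (2 * π) := by positivity
  have hKb : ∀ t, |K t| ≤ 1 / (2 * π) * weilDecayW 0 (fun x => (σ x : ℂ)) / (1 + t ^ 2) := by
    intro t
    rw [hKre]
    have h := abs_re_weilMellin_line_le hW₀ (1 / (2 * π)) t
    rwa [abs_of_pos h2π] at h
  have hKi : Integrable K := by
    refine Integrable.mono'
      (integrable_inv_one_add_sq.const_mul (1 / (2 * π) * weilDecayW 0 (fun x => (σ x : ℂ))))
      hKc.aestronglyMeasurable (Eventually.of_forall fun t => ?_)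
    rw [Real.norm_eq_abs, ← div_eq_mul_inv]
    exact hKb t
  have hinv : ∀ x : ℝ, ∫ u, (K u : ℂ) * cexp (-((u : ℂ) * I) * (x : ℂ)) = (σ x : ℂ) :=
    kernel_inversion hσ hσs hσe hKt
  have hinv' : ∀ x : ℝ, ∫ u, (K u : ℂ) * cexp ((u : ℂ) * (x : ℂ) * I) = (σ x : ℂ) :=
    kernel_inversion' hσ hσs hσe hKt
  -- the decay constants
  have hD₀ := weilDecayW_nonneg 0 (fun x => (σ x : ℂ))
  have hD₁ := weilDecayW_nonneg 0 (fun x : ℝ => I * (x : ℂ) * (σ x : ℂ))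
  have hD₂ := weilDecayW_nonneg 0 (fun x : ℝ => I * (x : ℂ) * (I * (x : ℂ) * (σ x : ℂ)))
  refine ⟨K,
    fun t : ℝ => 1 / (2 * π) *
      (weilMellin (fun x : ℝ => I * (x : ℂ) * (σ x : ℂ)) (1 / 2 + (t : ℂ) * I)).re,
    fun t : ℝ => 1 / (2 * π) *
      (weilMellin (fun x : ℝ => I * (x : ℂ) * (I * (x : ℂ) * (σ x : ℂ))) (1 / 2 + (t : ℂ) * I)).re,
    1 / (2 * π) * (weilDecayW 0 (fun x => (σ x : ℂ)) +
      weilDecayW 0 (fun x : ℝ => I * (x : ℂ) * (σ x : ℂ)) +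
      weilDecayW 0 (fun x : ℝ => I * (x : ℂ) * (I * (x : ℂ) * (σ x : ℂ)))),
    hKt, hKd, fun t => hasDerivAt_re_weilMellin_line hW₁.1.continuous hW₁.2 _ t,
    continuous_re_weilMellin_line hW₂.1.continuous hW₂.2 _, fun t => ?_, fun t => ?_,
    fun t => ?_, fun t => ?_, kernel_inversion_real hσ hσs hσe hKt hKi, fun A hA t => ?_,
    fun g hg hg' => ⟨integral_kernel_sub_mul_weilMellin hKc hKi hinv hg hg',
      integral_weilMellin_mul_kernel hKc hKi hinv' hg hg'⟩⟩
  · -- evenness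
    rw [hKt, hKt]
    simp only [neg_mul, Real.cos_neg]
  · -- decay of `K`
    refine (hKb t).trans ?_
    gcongr
    linarith
  · -- decay of `K'`
    have h := abs_re_weilMellin_line_le hW₁ (1 / (2 * π)) t
    rw [abs_of_pos h2π] at h
    refine h.trans ?_
    gcongr
    linarith
  · -- decay of `K''`
    have h := abs_re_weilMellin_line_le hW₂ (1 / (2 * π)) t
    rw [abs_of_pos h2π] at h
    refine h.trans ?_
    gcongr
    linarith
  · -- dilation
    rw [hKt]
    exact kernel_dilation σ hA t

end Summit.RiemannHypothesis.RiemannHypothesis.Theorems.SpectralThesis.Sketch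

end
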